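import Mathlib
import Summits.ResolutionOfSingularities.ResolutionOfSingularities.Theorems.HomologicalConductorPersistenceCyclicQuotientCompletionDomain
import Summits.ResolutionOfSingularities.ResolutionOfSingularities.Theorems.HomologicalConductorPersistenceSurfaceSaturationResidualFourToric
import HarnessLib

/-!
# Rung S-2 `PersistenceSurface` (stmt-ResolutionOfSingularities-19970), stub C1 (`Sat₄`) — the fourth residual with the
# analytically-toric exemption, NO SIDE HYPOTHESIS (route vocabulary), and the door of record

[OURS · cell decomp-res · rung S-2; seat leafhand-res-homologicalconduct-17 gen 0]  Nothing here is a statement of the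
manuscript under review (Hironaka 2017); AI-written, weaker than expert review.  DEF-FREE.  Nothing is asserted in the door:
every premise is a hypothesis.

`…SaturationResidualFourToric` (this seat) exempted the analytically-toric residual stages from stub C1 at the price of
«`T̂` is a domain»; `…CyclicQuotientCompletionDomain` (this seat) proved that the completed cyclic quotient IS a domain.  Here
the two are combined: a residual stage `T = ↥(tower O A m)` is exempted as soon as `T̂ ≃+* Ŝ` for a noetherian local
localisation `S` of some `U = k₀[u,v]^{(n;1,q)}` (`gcd(q,n) = 1`, `k₀ : Type` any field) at its vertex — nothing else.

* `ca_subset_caAt_four_of_analyticallyToric'` — `ca T ⊆ caAt 4 T` for a subalgebra stage with `T̂ ≃+* Ŝ` (u-polymorphic);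
* `saturationFourSurfaceResidual₄_of_toric_exemption'` — stub C1 from `Sat₄` off the analytically-toric residual stages;
* `persistenceSurface_of_toricExemptSat'_of_completedStep'_of_rest'` — `PersistenceSurface` (route decl by name) from
  {toric-exempted C1, C2 `CompletedStepPersistenceRationalNormal'`, C3′ `LevelFourPersistenceNonnormalOrNonrational'`}.

References: S. B. Iyengar, R. Takahashi, IMRN 2016 [`IyengarTakahashi2014`]; A. Bahlekeh, E. Hakimian, S. Salarian, R. Takahashi,
Q. J. Math. 67 (2016), Thm. 4.5 [`BahlekehHakimianSalarianTakahashi2015`] — through landed tree lemmas only.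
-/

-- single-problem summit: the doubled namespace component `ResolutionOfSingularities` is forced
set_option linter.dupNamespace false

noncomputable section

open IsLocalRing MvPolynomial Literature.RingTheory.CohomologyAnnihilator
open Summit.ResolutionOfSingularities.ResolutionOfSingularities.Theorems
open Summit.ResolutionOfSingularities.ResolutionOfSingularities.Theorems.NoZeno.Birth
open Summit.ResolutionOfSingularities.ResolutionOfSingularities.Theorems.HomologicalConductor.PersistenceSurfaceSaturationResidual
open Summit.ResolutionOfSingularities.ResolutionOfSingularities.Theorems.HomologicalConductor.PersistenceSurfaceSaturationResidualThree
open Summit.ResolutionOfSingularities.ResolutionOfSingularities.Theorems.HomologicalConductor.PersistenceSurfaceSaturationResidualFour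
open Summit.ResolutionOfSingularities.ResolutionOfSingularities.Theorems.HomologicalConductor.PersistenceSurfaceCompletedStepLevelFree
open Summit.ResolutionOfSingularities.ResolutionOfSingularities.Theorems.HomologicalConductor.PeriodicSaturationStage
  (ca_subset_caAt_of_le)
open Summit.ResolutionOfSingularities.ResolutionOfSingularities.Theorems.HomologicalConductor.PersistenceCyclicQuotientVertexIsolated
  (X_pow_mem)
open Summit.ResolutionOfSingularities.ResolutionOfSingularities.Theorems.HomologicalConductor.PersistenceCyclicQuotientCompletionDomain
  (cohomologyAnnihilator_le_caAt_four_of_ringEquiv_completion_vertex'')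
open Summit.ResolutionOfSingularities.ResolutionOfSingularities.Theorems.HomologicalConductor.PersistenceSurfaceSaturationResidualFourToric
  (isLocalRing_tower)

universe u

namespace Summit.ResolutionOfSingularities.ResolutionOfSingularities.Theorems.HomologicalConductor.PersistenceSurfaceSaturationResidualFourToricDomain

/-- **`ca T ⊆ caAt 4 T` at an analytically-toric subalgebra stage — no side hypothesis** (route vocabulary,
universe-polymorphic): `T ⊆ K` noetherian local, `U = k₀[u,v]^{(n;1,q)}` (`gcd(q,n) = 1`), `𝔪 ∋ uⁿ, vⁿ`, `S` a noetherian
local localisation of `U` at `𝔪`, `e : T̂ ≃+* Ŝ`. [OURS · cell decomp-res] -/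
theorem ca_subset_caAt_four_of_analyticallyToric' {k K : Type u} [Field k] [Field K] [Algebra k K] (T : Subalgebra k K)
    [IsNoetherianRing ↥T] [IsLocalRing ↥T]
    {k₀ : Type u} [Field k₀] {n : ℕ} [NeZero n] {q : ℕ} (U : Subalgebra k₀ (MvPolynomial (Fin 2) k₀))
    (hU : ∀ p, p ∈ U ↔ weightedHomogeneousComponent (![1, (q : ZMod n)] : Fin 2 → ZMod n) 0 p = p)
    (hq : q.Coprime n) (𝔪 : Ideal U) [𝔪.IsMaximal]
    (hu : (⟨(X 0 : MvPolynomial (Fin 2) k₀) ^ n, X_pow_mem U hU 0⟩ : U) ∈ 𝔪)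
    (hv : (⟨(X 1 : MvPolynomial (Fin 2) k₀) ^ n, X_pow_mem U hU 1⟩ : U) ∈ 𝔪)
    (S : Type u) [CommRing S] [Algebra U S] [IsLocalization.AtPrime S 𝔪] [IsNoetherianRing S] [IsLocalRing S]
    (e : AdicCompletion (maximalIdeal ↥T) ↥T ≃+* AdicCompletion (maximalIdeal S) S) :
    {x : K | ∃ hx : x ∈ T, ∃ m : ℕ, ∀ i : ℕ, m ≤ i → ∀ (M N : ModuleCat.{u} ↥T),
        Module.Finite ↥T M → Module.Finite ↥T N →
          ∀ e : CategoryTheory.Abelian.Ext.{u} M N i, (⟨x, hx⟩ : ↥T) • e = 0} ⊆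
      {x : K | ∃ hx : x ∈ T, ∀ i : ℕ, 4 ≤ i → ∀ (M N : ModuleCat.{u} ↥T),
        Module.Finite ↥T M → Module.Finite ↥T N →
          ∀ e : CategoryTheory.Abelian.Ext.{u} M N i, (⟨x, hx⟩ : ↥T) • e = 0} :=
  ca_subset_caAt_of_le T (cohomologyAnnihilator_le_caAt_four_of_ringEquiv_completion_vertex'' U hU hq 𝔪 hu hv S e)

/-- **`SaturationFourSurfaceResidual₄` WITH THE ANALYTICALLY-TORIC EXEMPTION — no side hypothesis.**  The registered stub C1
follows if, at every residual stage `T = ↥(tower O A m)` (not regular, not a monic-hypersurface localisation, not an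
edim-candidate, singular successor, Krull dimension `2`), EITHER `T̂ ≃+* Ŝ` for a noetherian local localisation `S` at the
vertex of some `U = k₀[u,v]^{(n;1,q)}`, `gcd(q,n) = 1`, `k₀ : Type` any field, OR `ca T ⊆ caAt 4 T` holds. [OURS · cell decomp-res] -/
theorem saturationFourSurfaceResidual₄_of_toric_exemption'
    (h : ∀ p : ℕ, p.Prime → ∀ (k K : Type) [Field k] [CharP k p] [Field K] [Algebra k K]
      (O : ValuationSubring K) (A : Subalgebra k K), (∀ c : k, algebraMap k K c ∈ O) → A.FG →
      IsFractionRing ↥A K → A.toSubring ≤ O.toSubring → ringKrullDim ↥A ≤ 2 → ∀ m : ℕ,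
      ¬ IsRegularLocalRing ↥(tower O A m) → ¬ IsMonicHypersurfaceLocalization k 2 ↥(tower O A m) →
      ¬ IsEdimHypersurfaceCandidate 2 ↥(tower O A m) → ¬ IsRegularLocalRing ↥(tower O A (m + 1)) →
      ringKrullDim ↥(tower O A m) = (2 : ℕ) →
      (∀ [IsLocalRing ↥(tower O A m)],
        ∃ (k₀ : Type) (_ : Field k₀) (n : ℕ) (_ : NeZero n) (q : ℕ) (U : Subalgebra k₀ (MvPolynomial (Fin 2) k₀))
          (hU : ∀ p, p ∈ U ↔ weightedHomogeneousComponent (![1, (q : ZMod n)] : Fin 2 → ZMod n) 0 p = p)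
          (_ : q.Coprime n) (𝔪 : Ideal U) (_ : 𝔪.IsMaximal)
          (_ : (⟨(X 0 : MvPolynomial (Fin 2) k₀) ^ n, X_pow_mem U hU 0⟩ : U) ∈ 𝔪)
          (_ : (⟨(X 1 : MvPolynomial (Fin 2) k₀) ^ n, X_pow_mem U hU 1⟩ : U) ∈ 𝔪)
          (S : Type) (_ : CommRing S) (_ : Algebra U S) (_ : IsLocalization.AtPrime S 𝔪) (_ : IsNoetherianRing S)
          (_ : IsLocalRing S),
          Nonempty (AdicCompletion (maximalIdeal ↥(tower O A m)) ↥(tower O A m) ≃+* AdicCompletion (maximalIdeal S) S)) ∨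
      {x : K | ∃ hx : x ∈ tower O A m, ∃ n : ℕ, ∀ i : ℕ, n ≤ i → ∀ (M N : ModuleCat.{0} ↥(tower O A m)),
          Module.Finite ↥(tower O A m) M → Module.Finite ↥(tower O A m) N →
            ∀ e : CategoryTheory.Abelian.Ext.{0} M N i, (⟨x, hx⟩ : ↥(tower O A m)) • e = 0} ⊆
        {x : K | ∃ hx : x ∈ tower O A m, ∀ i : ℕ, 4 ≤ i → ∀ (M N : ModuleCat.{0} ↥(tower O A m)),
          Module.Finite ↥(tower O A m) M → Module.Finite ↥(tower O A m) N →
            ∀ e : CategoryTheory.Abelian.Ext.{0} M N i, (⟨x, hx⟩ : ↥(tower O A m)) • e = 0}) :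
    SaturationFourSurfaceResidual₄ := by
  intro p hp k K _ _ _ _ O A hk hA hfr hAO hdim caAt ca loc chart nrm tower' m hreg hmon hcand hsucc hdim2
  show NoZeno.Birth.ca (NoZeno.Birth.tower O A m) ⊆ _
  haveI : IsNoetherianRing ↥(tower O A m) := stub_towerNoetherian k K O A hk hA hfr hAO m
  haveI : IsLocalRing ↥(tower O A m) := isLocalRing_tower O A hk hAO m
  rcases h p hp k K O A hk hA hfr hAO hdim m hreg hmon hcand hsucc hdim2 with htor | hsat
  · obtain ⟨k₀, _, n, _, q, U, hU, hq, 𝔪, _, hu, hv, S, _, _, _, _, _, ⟨e⟩⟩ := htor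
    exact ca_subset_caAt_four_of_analyticallyToric' (tower O A m) U hU hq 𝔪 hu hv S e
  · exact hsat

/-- **Door of record with the analytically-toric exemption — no side hypothesis.**  `PersistenceSurface` (the route decl, by
name) follows from: (T) at every residual stage EITHER `T̂ ≃+* Ŝ` for a noetherian local vertex localisation `S` of some
`U = k₀[u,v]^{(n;1,q)}` (`gcd(q,n) = 1`) OR `ca T ⊆ caAt 4 T`; (C2) `CompletedStepPersistenceRationalNormal'`; (C3′)
`LevelFourPersistenceNonnormalOrNonrational'`.  Nothing is asserted. [cite: BahlekehHakimianSalarianTakahashi2015, Thm. 4.5] -/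
theorem persistenceSurface_of_toricExemptSat'_of_completedStep'_of_rest'
    (hT : ∀ p : ℕ, p.Prime → ∀ (k K : Type) [Field k] [CharP k p] [Field K] [Algebra k K]
      (O : ValuationSubring K) (A : Subalgebra k K), (∀ c : k, algebraMap k K c ∈ O) → A.FG →
      IsFractionRing ↥A K → A.toSubring ≤ O.toSubring → ringKrullDim ↥A ≤ 2 → ∀ m : ℕ,
      ¬ IsRegularLocalRing ↥(tower O A m) → ¬ IsMonicHypersurfaceLocalization k 2 ↥(tower O A m) →
      ¬ IsEdimHypersurfaceCandidate 2 ↥(tower O A m) → ¬ IsRegularLocalRing ↥(tower O A (m + 1)) →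
      ringKrullDim ↥(tower O A m) = (2 : ℕ) →
      (∀ [IsLocalRing ↥(tower O A m)],
        ∃ (k₀ : Type) (_ : Field k₀) (n : ℕ) (_ : NeZero n) (q : ℕ) (U : Subalgebra k₀ (MvPolynomial (Fin 2) k₀))
          (hU : ∀ p, p ∈ U ↔ weightedHomogeneousComponent (![1, (q : ZMod n)] : Fin 2 → ZMod n) 0 p = p)
          (_ : q.Coprime n) (𝔪 : Ideal U) (_ : 𝔪.IsMaximal)
          (_ : (⟨(X 0 : MvPolynomial (Fin 2) k₀) ^ n, X_pow_mem U hU 0⟩ : U) ∈ 𝔪)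
          (_ : (⟨(X 1 : MvPolynomial (Fin 2) k₀) ^ n, X_pow_mem U hU 1⟩ : U) ∈ 𝔪)
          (S : Type) (_ : CommRing S) (_ : Algebra U S) (_ : IsLocalization.AtPrime S 𝔪) (_ : IsNoetherianRing S)
          (_ : IsLocalRing S),
          Nonempty (AdicCompletion (maximalIdeal ↥(tower O A m)) ↥(tower O A m) ≃+* AdicCompletion (maximalIdeal S) S)) ∨
      {x : K | ∃ hx : x ∈ tower O A m, ∃ n : ℕ, ∀ i : ℕ, n ≤ i → ∀ (M N : ModuleCat.{0} ↥(tower O A m)),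
          Module.Finite ↥(tower O A m) M → Module.Finite ↥(tower O A m) N →
            ∀ e : CategoryTheory.Abelian.Ext.{0} M N i, (⟨x, hx⟩ : ↥(tower O A m)) • e = 0} ⊆
        {x : K | ∃ hx : x ∈ tower O A m, ∀ i : ℕ, 4 ≤ i → ∀ (M N : ModuleCat.{0} ↥(tower O A m)),
          Module.Finite ↥(tower O A m) M → Module.Finite ↥(tower O A m) N →
            ∀ e : CategoryTheory.Abelian.Ext.{0} M N i, (⟨x, hx⟩ : ↥(tower O A m)) • e = 0})
    (hC : CompletedStepPersistenceRationalNormal') (hN : LevelFourPersistenceNonnormalOrNonrational') :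
    Summit.ResolutionOfSingularities.ResolutionOfSingularities.Theses.HomologicalConductor.PersistenceSurface :=
  persistenceSurface_of_residual₄_of_completedStep'_of_rest' (saturationFourSurfaceResidual₄_of_toric_exemption' hT) hC hN

end Summit.ResolutionOfSingularities.ResolutionOfSingularities.Theorems.HomologicalConductor.PersistenceSurfaceSaturationResidualFourToricDomain

end
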